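import Literature.Probability.RandomPlanarGeometry.SAWPatternFiniteMemoryCheck
import HarnessLib

/-!
# Memory-16 certificate for ALL-TURN self-avoiding walks on `ℤ²` (`native_decide`)

Topic `Literature/Probability/RandomPlanarGeometry` (an instance of `FiniteMemory.checkPC`,
`SAWPatternFiniteMemoryCheck.lean`). One compiled evaluation of
`FiniteMemory.checkPC 16 0 100000 1 159512000 1000 80`: the turn-tilted memory-16 Pönitz–Tittmann
certificate on `58 411` normal forms with letter weight `M = 10⁵` on a letter completing a turn and `1`
otherwise, ratio `159512000/1000`. Certified (by `sum_sawWords_patW_mul_pow_le_of_checkPC`):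
`Σ_{w ∈ sawWords n} (10⁵)^{#turns(w)} · 1000ⁿ ≤ 159512000ⁿ · 2⁴¹`; since an ALL-TURN word (every
internal vertex a turn, `#turns = n - 1`) weighs `10^{5(n-1)}`, the number `a(n)` of all-turn `n`-step
self-avoiding walks satisfies **`a(n) ≤ 2⁴¹ · 10⁵ · 1.59512ⁿ`** (`SAWAllTurnGrowthZ2.lean`), i.e. the
growth constant of all-turn walks (= the connective constant of the `L`-lattice, numerically
`1.5657`) is at most `1.59512` (the memory-3 Fibonacci bound is `φ = 1.618…`). Telemetry `ratioPC`:
`159511995160`·10⁻⁶ at `K = 16` and `159511957374`·10⁻⁶ at `K = 18` — memory 18 gives nothing over 16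
because all-turn loops have length `≡ 0 (mod 4)`. The only non-standard axiom is `Lean.ofReduceBool`;
the evaluation takes ≈ 60 s. [cite: PonitzTittmann2000, §3; MadrasSlade1993, §7.2]
-/

namespace Literature.Probability.RandomPlanarGeometry.SAW.FiniteMemory

/-- The memory-16 all-turn certificate (turn weight `10⁵`, straight weight `1`):
`checkPC 16 0 100000 1 159512000 1000 80`. [cite: PonitzTittmann2000, §3] -/
theorem checkPC_16_allturn : checkPC 16 0 100000 1 159512000 1000 80 = true := by
  native_decide

end Literature.Probability.RandomPlanarGeometry.SAW.FiniteMemory
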